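import Summits.QuantumFields.YangMills.Theorems.ComplexCouplingChannelFreeEnergyWindowChannelStubReChain
import Summits.QuantumFields.YangMills.Theorems.ComplexCouplingChannelFreeEnergyWindowChannelStubLocalRePart
import HarnessLib

/-!
# Pinned windows decay exponentially, uniformly on compact sets

Stub `stub_expDecayOnCompacts` of line `Sketch` (layer 5: the window is exponentially thin) for the crux
`FreeEnergyWindowChannel` (`stmt-QuantumFields-18842`, route `ComplexCouplingChannel` of `QuantumFields/YangMills`).
Pure one-complex-variable analysis; the abstract engine `remainder_tendsto_zero_of_window_of_pinning`
(`FreeEnergyWindowChannel/Negative/TorusRemainderRigidity`) WITH AN EXPONENTIAL RATE, uniform on a compact `K ⊆ D`.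

Setting: `Z_P` entire (`P : ℕ`), `f` holomorphic on an open preconnected `D ⊆ ℂ`, and for `P ≥ P₀` the window
`Z_P z ≠ 0 ∧ |u_P z| ≤ M` on `D`, where `u_P := log ‖Z_P‖ + P⁴ Re f`; moreover `|u_P| ≤ A e^{-aP}` on the part of
`D` within distance `r₀` of a point `x ∈ D`.  Conclusion: on every compact `K ⊆ D`, `|u_P| ≤ e^{-cP}` for some
`c > 0` and all large `P`.

Proof.  `u_P` is, on every disc inside `D`, the real part of a holomorphic function (local holomorphic logarithm,
`exists_differentiableOn_re_eq_log_norm`, plus `(P : ℂ)⁴ f`), so the landed real-part two-constants chain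
`stub_reChain` on `K` (exponent `θ ∈ (0, 1]`, constant `C₀ ≥ 1`, both uniform on `K` and independent of `u`) gives,
with `B := max M 1` and `ε_P := A e^{-aP} ≤ 1`,
`|u_P z| ≤ C₀ ε_P^θ B^{1-θ} = (C₀ A^θ B^{1-θ}) e^{-(aθ)P}` on `K`.  With `c := aθ/2` the constant is absorbed into
half the rate: `C₀ A^θ B^{1-θ} e^{-(aθ/2)P} ≤ 1` for all large `P`.  The threshold `P₁` is extracted from an
`atTop`-eventuality (`ε_P → 0`, `C₀ A^θ B^{1-θ} e^{-(aθ/2)P} → 0`, `P ≥ P₀`).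

References: R. Nevanlinna, *Eindeutige analytische Funktionen* (1936), §III.2 (two-constants theorem) — via
`stub_reChain`; Mathlib `Real.mul_rpow`, `Real.exp_mul`, `Real.tendsto_exp_neg_atTop_nhds_zero`.
Deliberately NOT here: anything about Wilson partition functions or the crux itself (that composition is the lead's
`stub_expWindowAt`).
-/

set_option autoImplicit false

open scoped Topology
open Filter Set Metric

namespace Summit.QuantumFields.YangMills.Theorems.FreeEnergyWindowChannel

/-- **Pinned windows decay exponentially on compacts** (registered stub `stub_expDecayOnCompacts` of line `Sketch`,
layer 5).  Let `Z_P` be entire, `f` holomorphic on an open preconnected `D`, and suppose that for `P ≥ P₀` the window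
`Z_P z ≠ 0 ∧ |log ‖Z_P z‖ + P⁴ Re f z| ≤ M` holds on `D`, while on `D ∩ {dist · x < r₀}` (`x ∈ D`, `r₀ > 0`) the same
quantity is `≤ A e^{-aP}` (`A, a > 0`).  Then for every compact `K ⊆ D` there are `c > 0` and `P₁` with
`|log ‖Z_P z‖ + P⁴ Re f z| ≤ e^{-cP}` for all `P ≥ P₁` and `z ∈ K`.  Proof: `u_P = log ‖Z_P‖ + P⁴ Re f` is locally the
real part of a holomorphic function (`exists_differentiableOn_re_eq_log_norm`), so the real-part two-constants chain
`stub_reChain` on `K` gives `|u_P| ≤ C₀ (A e^{-aP})^θ (max M 1)^{1-θ}` on `K` once `A e^{-aP} ≤ 1`; take `c = aθ/2`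
and absorb the constant `C₀ A^θ (max M 1)^{1-θ}` into the other half of the rate for large `P`. [folklore] -/
theorem stub_expDecayOnCompacts :
    ∀ (Z : ℕ → ℂ → ℂ) (D : Set ℂ), IsOpen D → IsPreconnected D → (∀ P : ℕ, Differentiable ℂ (Z P)) →
      ∀ x ∈ D, ∀ r₀ : ℝ, 0 < r₀ → ∀ f : ℂ → ℂ, DifferentiableOn ℂ f D → ∀ (M : ℝ) (P₀ : ℕ),
      (∀ P : ℕ, P₀ ≤ P → ∀ z ∈ D, Z P z ≠ 0 ∧ |Real.log ‖Z P z‖ + (P : ℝ) ^ 4 * (f z).re| ≤ M) →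
      ∀ A a : ℝ, 0 < A → 0 < a →
      (∀ P : ℕ, P₀ ≤ P → ∀ z ∈ D, dist z x < r₀ → |Real.log ‖Z P z‖ + (P : ℝ) ^ 4 * (f z).re| ≤ A * Real.exp (-(a * P))) →
      ∀ K : Set ℂ, IsCompact K → K ⊆ D →
        ∃ c : ℝ, 0 < c ∧ ∃ P₁ : ℕ, ∀ P : ℕ, P₁ ≤ P → ∀ z ∈ K,
          |Real.log ‖Z P z‖ + (P : ℝ) ^ 4 * (f z).re| ≤ Real.exp (-(c * P)) := by
  intro Z D hDo hDc hZ x hx r₀ hr₀ f hf M P₀ hwin A a hA ha hpin K hK hKD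
  -- the uniform exponent and constant of the real-part chain on `K`
  obtain ⟨θ, hθ0, -, C₀, hC₀, hchain⟩ := stub_reChain D hDo hDc x hx r₀ hr₀ K hK hKD
  have hC₀0 : 0 < C₀ := lt_of_lt_of_le one_pos hC₀
  -- the global bound `B = max M 1`
  obtain ⟨B, hMB, h1B⟩ : ∃ B : ℝ, M ≤ B ∧ 1 ≤ B := ⟨max M 1, le_max_left _ _, le_max_right _ _⟩
  have hB0 : 0 < B := lt_of_lt_of_le one_pos h1B
  -- Step 1: the chain bound on `K` for every `P ≥ P₀` with `A e^{-aP} ≤ 1`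
  have hbound : ∀ P : ℕ, P₀ ≤ P → A * Real.exp (-(a * P)) ≤ 1 → ∀ z ∈ K,
      |Real.log ‖Z P z‖ + (P : ℝ) ^ 4 * (f z).re| ≤
        C₀ * (A * Real.exp (-(a * P))) ^ θ * B ^ (1 - θ) := by
    intro P hP hε1
    set u : ℂ → ℝ := fun w => Real.log ‖Z P w‖ + (P : ℝ) ^ 4 * (f w).re with hu
    -- `u` is locally the real part of a holomorphic function on `D`
    have hure : ∀ (c : ℂ) (R : ℝ), 0 < R → ball c R ⊆ D →
        ∃ φ : ℂ → ℂ, DifferentiableOn ℂ φ (ball c R) ∧ ∀ w ∈ ball c R, (φ w).re = u w := by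
      intro c R hR hsub
      obtain ⟨g, hgd, hg⟩ := exists_differentiableOn_re_eq_log_norm hR ((hZ P).differentiableOn)
        fun w hw => (hwin P hP w (hsub hw)).1
      refine ⟨fun w => g w + (P : ℂ) ^ 4 * f w, hgd.add ((differentiableOn_const _).mul (hf.mono hsub)), ?_⟩
      intro w hw
      have hre : ((P : ℂ) ^ 4 * f w).re = (P : ℝ) ^ 4 * (f w).re := by
        rw [show ((P : ℂ) ^ 4) = (((P : ℝ) ^ 4 : ℝ) : ℂ) from by push_cast; ring, Complex.re_ofReal_mul]
      simp only [hu, Complex.add_re, hg w hw, hre]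
    have hbig : ∀ w ∈ D, |u w| ≤ B := fun w hw => ((hwin P hP w hw).2).trans hMB
    have hsmall : ∀ w ∈ D, dist w x < r₀ → |u w| ≤ A * Real.exp (-(a * P)) :=
      fun w hw hwx => hpin P hP w hw hwx
    have hε0 : 0 < A * Real.exp (-(a * P)) := by positivity
    intro z hz
    exact hchain u B (A * Real.exp (-(a * P))) hure hε0 (hε1.trans h1B) hbig hsmall z hz
  -- Step 2: exponent bookkeeping, `C₀ (A e^{-aP})^θ B^{1-θ} = (C₀ A^θ B^{1-θ}) e^{-(aθ/2)P} e^{-(aθ/2)P}`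
  have hc : 0 < a * θ / 2 := by positivity
  have hrew : ∀ P : ℕ, C₀ * (A * Real.exp (-(a * P))) ^ θ * B ^ (1 - θ) =
      C₀ * A ^ θ * B ^ (1 - θ) * Real.exp (-(a * θ / 2 * P)) * Real.exp (-(a * θ / 2 * P)) := by
    intro P
    have h1 : (A * Real.exp (-(a * P))) ^ θ = A ^ θ * Real.exp (-(a * P) * θ) := by
      rw [Real.mul_rpow hA.le (Real.exp_pos _).le, ← Real.exp_mul]
    have h2 : Real.exp (-(a * P) * θ) = Real.exp (-(a * θ / 2 * P)) * Real.exp (-(a * θ / 2 * P)) := by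
      rw [← Real.exp_add]; congr 1; ring
    rw [h1, h2]; ring
  -- Step 3: eventualities in `P`
  have hexp0 : ∀ b : ℝ, 0 < b → Tendsto (fun P : ℕ => Real.exp (-(b * P))) atTop (𝓝 0) := by
    intro b hb
    have := Real.tendsto_exp_neg_atTop_nhds_zero.comp
      ((tendsto_natCast_atTop_atTop (R := ℝ)).const_mul_atTop hb)
    simpa [Function.comp_def] using this
  have hεt : Tendsto (fun P : ℕ => A * Real.exp (-(a * P))) atTop (𝓝 0) := by
    simpa using (hexp0 a ha).const_mul A
  have hLt : Tendsto (fun P : ℕ => C₀ * A ^ θ * B ^ (1 - θ) * Real.exp (-(a * θ / 2 * P))) atTop (𝓝 0) := by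
    simpa using (hexp0 (a * θ / 2) hc).const_mul (C₀ * A ^ θ * B ^ (1 - θ))
  have hev : ∀ᶠ P : ℕ in atTop, ∀ z ∈ K,
      |Real.log ‖Z P z‖ + (P : ℝ) ^ 4 * (f z).re| ≤ Real.exp (-(a * θ / 2 * P)) := by
    have h1 : ∀ᶠ P : ℕ in atTop, A * Real.exp (-(a * P)) < 1 := hεt.eventually (gt_mem_nhds one_pos)
    have h2 : ∀ᶠ P : ℕ in atTop, P₀ ≤ P := eventually_ge_atTop P₀
    have h3 : ∀ᶠ P : ℕ in atTop, C₀ * A ^ θ * B ^ (1 - θ) * Real.exp (-(a * θ / 2 * P)) < 1 :=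
      hLt.eventually (gt_mem_nhds one_pos)
    filter_upwards [h1, h2, h3] with P hP1 hP2 hP3 z hz
    calc |Real.log ‖Z P z‖ + (P : ℝ) ^ 4 * (f z).re|
        ≤ C₀ * (A * Real.exp (-(a * P))) ^ θ * B ^ (1 - θ) := hbound P hP2 hP1.le z hz
      _ = C₀ * A ^ θ * B ^ (1 - θ) * Real.exp (-(a * θ / 2 * P)) * Real.exp (-(a * θ / 2 * P)) := hrew P
      _ ≤ 1 * Real.exp (-(a * θ / 2 * P)) := mul_le_mul_of_nonneg_right hP3.le (Real.exp_pos _).le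
      _ = Real.exp (-(a * θ / 2 * P)) := one_mul _
  -- Step 4: extract the threshold
  obtain ⟨P₁, hP₁⟩ := Filter.eventually_atTop.1 hev
  exact ⟨a * θ / 2, hc, P₁, fun P hP z hz => hP₁ P hP z hz⟩

end Summit.QuantumFields.YangMills.Theorems.FreeEnergyWindowChannel
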